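import Literature.MathematicalPhysics.QuantumFieldTheory.Balaban1983to89.B9Eq353FormDefectTowerDiagonal
import Literature.MathematicalPhysics.QuantumFieldTheory.Balaban1983to89.B9Eq315QTowerLipschitzL2TwoBackgroundsChain
import Literature.MathematicalPhysics.QuantumFieldTheory.Balaban1983to89.B9Ineq369CurvatureTwoBackgroundsPlaquette
import Literature.MathematicalPhysics.QuantumFieldTheory.Balaban1983to89.B9Eq373DerivativeRemainderTwoBackgrounds
import Literature.MathematicalPhysics.QuantumFieldTheory.Balaban1983to89.B9Eq368RLipschitzTwoBackgrounds

/-!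
# `Balaban1983to89.B9Eq353FormDefectTowerTwoBackgrounds` — T. Bałaban, *Propagators for lattice gauge theories in a background field*, Commun. Math. Phys. **99**
# (1985) 389–434 [Balaban1985BackgroundPropagators] (3.52)–(3.53) p. 400 *«Δ_{U′U} = Δ_U − V₁(A)»* with (3.82)–(3.86) p. 407 AT `k = n+1` AVERAGING LEVELS ON
# PRINT's DIAGONAL `ηL^{n+1} = 1`, BETWEEN TWO SMALL BACKGROUNDS: **THE FORM DEFECT `|⟨u, (Δ^{(k)}_a(U) − Δ^{(k)}_a(V))v⟩| ≤ Θ̄₂·δ·N₁(u)·N₁(v)` IN THE FLAT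
# ENERGY WEIGHT `N₁`, `Θ̄₂` CLOSED AND FREE OF `η`, THE VOLUME AND THE NUMBER OF LEVELS** — the two-background («(b3)») twin of the NE9 owner's 4a
# `B9Eq353FormDefectTowerDiagonal` (iii) (there `V = 1`, `δ = α`), from FIRST-order letters only, composed by `B9Eq386GreenLipschitzEnergy.norm_inner_laplaceAK_sub_le`

statement-level skeleton of published theorems with citation tags; proofs where landed; nothing here is a claim about the Yang–Mills mass gap

PDF held: `paper:balaban1985-cmp99-background-propagators` (journal page = PDF page + 388), pp. 395–396, 400, 404, 407 through the suppliers' quotations.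
CITATION HEADER (lean-in-tree rule 2026-08-18).  Audit cell `pub-balaban`, sub-cell `t4`, NE9 crux team (2): LEAF PROVER 04 (`b2b-balaban-t4-ne9-formalise-leaf-04`
gen 77), INTENT-7.  WHY: the two-background twins of the owner's energy-norm perturbation storeys (4b Green, 5 `H_{1,k}`, 6 `𝔊_k`) consume THIS form defect.

THE PRINT.  (3.52)–(3.53) p. 400: *«Δ_{U′U} = Δ_U − V₁(A)»* — the first-order part of the expansion of `Δ_a` about a background; (3.82)–(3.86) p. 407: the
letters `Q`, `R`, `D` are Lipschitz in the background; (3.35) p. 396: the η-scaled small-field class.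

WHAT IS PROVED (sorry-free; 0 `def`; [folklore] composition BY NAME + threshold arithmetic; nothing of [B9] asserted as printed).
* **`exists_form_defect_two_backgrounds_diagonal_closed`** — `∃ α₀ δ₀ Θ̄₂ > 0` BEFORE `n, η` (`ηL^{n+1} = 1`), `c₀, c₁` (`c₀(L^{n+1})^d = c₁`, `|η|^d∕c₀ ≤ ρ_w`), `m`,
  TWO backgrounds `U`, `V` with E162's per-level data (the base `V` also `α′_j ≤ 1∕128`), common level smallness `ε_j ≤ αr^j`, level closeness
  `‖Ū^j(b) − V̄^j(b)‖ ≤ δ_j ≤ δr^j`, `hRS` for both, the windows `‖U(b) − 1‖, ‖V(b) − 1‖ ≤ αη`, `‖U(∂p) − 1‖ ≤ αη²`, the CLOSENESS windows `‖U(b) − V(b)‖ ≤ δη`,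
  `‖U(∂p) − V(∂p)‖ ≤ δη²`, `0 ≤ α ≤ α₀`, `0 ≤ δ ≤ δ₀`, the `R`-letter `‖R_k(U)s − R_k(V)s‖ ≤ C_R^{(2)}δ‖s‖`: `‖⟨u, Δ_a(U)v⟩ − ⟨u, Δ_a(V)v⟩‖ ≤ Θ̄₂·δ·N₁(u)N₁(v)`.
MODEL ∕ DECLARED READINGS.  (M1)–(M3) of `B9Eq353FormDefectTowerDiagonal`.  (M4) every window ∕ profile ∕ closeness letter DISPLAYED (the Lipschitz
continuity `U ↦ Ū` of the averages is NOT proved here; `C_R^{(2)}` is a hypothesis letter, inhabited by `B9Eq325RLipschitzSqrtTowerTwoBackgroundsLinear`'s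
`max(3s_{A,2}∕s_V, 2∕δ₀)` under its own windows); the plaquette closeness `δη²` is the two-background twin of the plaquette window; the closeness profile `δ_j ≤ δr^j` is asked for ALL `j` (levels `j ≥ n+1` are vacuous for the consumer, who may put `δ_j := 0` there) because the tower letter's Cauchy radius `δ_j ≤ 1∕(12288N)` is stated levelwise.  (M5) crude constants
(`α, δ ≤ 1` used to freeze the `α`-dependence of the letters); the main theorem elaborates under `set_option maxHeartbeats 400000` (twice the default:
the abstract composition unifies ten operator slots at once).
HONEST SCOPE.  FIRST order between two small backgrounds on the diagonal ONLY; no coercivity restated (4a (i) at `U` and at `V`); no kernel bound, no decay.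
NOT summit progress (cell pub-balaban: NE9 NOT PRINTED ∕ NOT PROVED; «NE9 ⇐ the named binders»; row WALLED ON A MODEL; spine PROVED 0∕9; rung (B)+1 finite T⁴ —
NOT infinite volume, NOT mass gap, NOT BetaPertH, NOT Clay).  HONEST DEPENDENCY (cell line): continuum YM on T⁴ ⇐ BetaPertH ∧ nine spine estimates (0/9 proved);
BetaPertH ⇐ (D1) ∧ (D4) ∧ CAP+tail; G-an2-4 gates asym, D1 and NE2/3/4.  NEW file; nothing modified.  Net new unproved facts: 0.
-/

noncomputable section

open scoped InnerProductSpace ComplexConjugate BigOperators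

namespace Literature.MathematicalPhysics.QuantumFieldTheory.Balaban1983to89.B9Eq353FormDefectTowerTwoBackgrounds

open B4Sect5Torus (TSite)
open B9SectCLatticeCarrier (Bond)
open B11Eq103H1Complex (SiteL2K BondL2K covDerivL2K covDivL2K laplaceALatticeK laplaceAK adjoint_covDerivL2K projR_projR)
open B9Eq310HessianOperator (adTransportW principalOpK curvOp hessOp hessOp_apply covCurlL2K principalOpK_eq_comp covCoCurlL2K_comp_eq_adjoint_comp)
open B9Eq310DeltaPrime (plaqHolU)
open B9Eq315QTorus (perCfg cornerSite)
open B9Eq315QTower (towerP UlevOf)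
open B9Eq315QTowerFlat (perCfg_UlevOf_one_mem_U1 norm_Wcx_UlevOf_one_sub_one_le)
open B9Eq326OperatorTower (laplaceAk QkW RofUk RofUk_isSymmetric)
open B7Prop1Explicit (U1 Wcx boxVec)
open B9Eq373DerivativeRemainderL2 (norm_covCurlL2K_sub_le norm_covDivL2K_sub_le)
open B9Eq373DerivativeRemainderTwoBackgrounds (norm_covCurlL2K_sub_le₂ norm_covDivL2K_sub_le₂)
open B9Eq368ProjectionRemainder (norm_projR_le)
open B9Eq384RemainderLetters (norm_adTransportW_sub_le)
open B9Eq368RLipschitzTwoBackgrounds (norm_adTransportW_sub_adTransportW_le)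
open B9Eq315QTowerLipschitzL2 (norm_QkW_sub_flat_le_L2_geometric)
open B9Eq315QTowerLipschitzL2TwoBackgroundsChain (norm_QkW_sub_QkW_le_L2_linear)
open B9Eq315QTowerFlatNorm (norm_QkW_one_le_canonical)
open B5Eq172HodgePositivity (adTransportW_one adTransportW_inv_one hRS_one)
open B9Ineq369CurvatureTwoBackgroundsPlaquette (norm_curvOp_sub_le_of_plaq)
open B9Eq386GreenLipschitzEnergy (norm_inner_sub_inner_le norm_inner_laplaceAK_sub_le)

/-! ## §0 Arithmetic -/

/-- `e^y − 1 ≤ 2y` for `0 ≤ y ≤ 1`. [folklore] -/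
private theorem exp_sub_one_le_two_mul {y : ℝ} (hy0 : 0 ≤ y) (hy1 : y ≤ 1) : Real.exp y - 1 ≤ 2 * y := by
  have h := Real.abs_exp_sub_one_sub_id_le (x := y) (by rw [abs_of_nonneg hy0]; exact hy1)
  have h1 : Real.exp y - 1 - y ≤ y ^ 2 := (le_abs_self _).trans h
  have h2 : y ^ 2 ≤ y := by rw [pow_two]; exact mul_le_of_le_one_left hy0 hy1
  linarith

/-- on the diagonal the carrier ratio is `1`: `√(c₁∕(c₀(L^{n+1})^d)) = 1`. [cite: Balaban1985BackgroundPropagators, (3.16) p.393] -/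
private theorem sqrt_ratio_diagonal {d L n : ℕ} {c₀ c₁ : ℝ} (hc₁ : 0 < c₁) (hw : c₀ * ((L : ℝ) ^ (n + 1)) ^ d = c₁) :
    Real.sqrt (c₁ / (c₀ * ((L : ℝ) ^ (n + 1)) ^ d)) = 1 := by
  rw [hw, div_self hc₁.ne', Real.sqrt_one]

/-- `x ≤ √S` from `x² ≤ S`, `x ≥ 0`. [folklore] -/
private theorem le_sqrt_of_sq_le {x S : ℝ} (hx : 0 ≤ x) (h : x ^ 2 ≤ S) : x ≤ Real.sqrt S := by
  rw [← Real.sqrt_sq hx]; exact Real.sqrt_le_sqrt h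

/-- the curvature letter's size on the diagonal: `16dC_τM_φ²(|η|^d∕c₀)·|η|⁻²(12δη·αη² + 3δη²) ≤ 16dC_τM_φ²ρ_w·15·δ` (`α, η ≤ 1`). [folklore] -/
private theorem curv_coeff_le {d : ℕ} {Cτ Mφ ρw η α δ c₀ nη : ℝ} (hCτ : 0 ≤ Cτ) (hc₀ : 0 < c₀) (hρ : |η| ^ d / c₀ ≤ ρw) (hnη2 : nη ^ 2 * η ^ 2 = 1)
    (hα1 : α ≤ 1) (hη0 : 0 ≤ η) (hη1 : η ≤ 1) (hδ0 : 0 ≤ δ) :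
    16 * d * Cτ * Mφ ^ 2 * (|η| ^ d / c₀) * (nη ^ 2 * (12 * (δ * η) * (α * η ^ 2) + 3 * (δ * η ^ 2))) ≤ 16 * d * Cτ * Mφ ^ 2 * ρw * 15 * δ := by
  have e : nη ^ 2 * (12 * (δ * η) * (α * η ^ 2) + 3 * (δ * η ^ 2)) = (12 * (α * η) + 3) * δ * (nη ^ 2 * η ^ 2) := by ring
  rw [e, hnη2, mul_one]
  have hαη : α * η ≤ 1 := (mul_le_mul hα1 hη1 hη0 zero_le_one).trans (by rw [one_mul])
  have h15 : (12 * (α * η) + 3) * δ ≤ 15 * δ := mul_le_mul_of_nonneg_right (by linarith) hδ0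
  have hpre : 0 ≤ 16 * d * Cτ * Mφ ^ 2 * (|η| ^ d / c₀) := by positivity
  have hpre' : 0 ≤ 16 * d * Cτ * Mφ ^ 2 := by positivity
  calc 16 * d * Cτ * Mφ ^ 2 * (|η| ^ d / c₀) * ((12 * (α * η) + 3) * δ) ≤ 16 * d * Cτ * Mφ ^ 2 * (|η| ^ d / c₀) * (15 * δ) :=
        mul_le_mul_of_nonneg_left h15 hpre
    _ ≤ 16 * d * Cτ * Mφ ^ 2 * ρw * (15 * δ) := mul_le_mul_of_nonneg_right (mul_le_mul_of_nonneg_left hρ hpre') (by positivity)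
    _ = 16 * d * Cτ * Mφ ^ 2 * ρw * 15 * δ := by ring

/-- the threshold arithmetic: the bracket is monotone in `α, δ ∈ [0,1]`. [folklore] -/
private theorem bracket_le {α δ sD Kc sS CR sQ MQ CQ a : ℝ} (hα0 : 0 ≤ α) (hα1 : α ≤ 1) (hδ0 : 0 ≤ δ) (hδ1 : δ ≤ 1) (hsD : 0 ≤ sD) (hsS : 0 ≤ sS) (hCR : 0 ≤ CR) (hsQ : 0 ≤ sQ) (hCQ : 0 ≤ CQ) (ha : 0 ≤ a) :
    sD * (2 * (1 + sD * α) + sD * δ) + Kc + (sS + CR * (1 + sS * α)) * (2 * (1 + sS * α) + (sS * δ + CR * δ * (1 + sS * α))) +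
        a * (sQ * (2 * (MQ + CQ * α) + sQ * δ)) ≤
      sD * (2 * (1 + sD * 1) + sD * 1) + Kc + (sS + CR * (1 + sS * 1)) * (2 * (1 + sS * 1) + (sS * 1 + CR * 1 * (1 + sS * 1))) +
        a * (sQ * (2 * (MQ + CQ * 1) + sQ * 1)) := by
  gcongr

/-! ## §1 The form defect between two small backgrounds on the diagonal -/

variable {d : ℕ} (L : ℕ) [NeZero L] (hL : 1 ≤ L)
  {𝔸 : Type*} [NormedRing 𝔸] [NormedAlgebra ℂ 𝔸] [CompleteSpace 𝔸] [NormOneClass 𝔸] [StarRing 𝔸] [NormedStarGroup 𝔸] [StarModule ℂ 𝔸]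
  {W : Type*} [NormedAddCommGroup W] [InnerProductSpace ℂ W] [FiniteDimensional ℂ W] (φ : W ≃ₗ[ℂ] 𝔸)
  {Mφ Mφ' : ℝ} (hMφ : 0 ≤ Mφ) (hMφ' : 0 ≤ Mφ') (hφ : ∀ w, ‖φ w‖ ≤ Mφ * ‖w‖) (hφ' : ∀ X, ‖φ.symm X‖ ≤ Mφ' * ‖X‖)
  {a : ℝ} (ha : 0 < a) {r : ℝ} (hr0 : 0 ≤ r) (hr1 : r < 1)
  (τ : 𝔸 →ₗ[ℂ] ℂ) {Cτ : ℝ} (hτ : ∀ X, ‖τ X‖ ≤ Cτ * ‖X‖) (hCτ : 0 ≤ Cτ) {ρw : ℝ} (hρw : 0 ≤ ρw) {CR : ℝ} (hCR : 0 ≤ CR)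

include hMφ hMφ' hφ hφ' ha hr0 hr1 hτ hCτ hρw hCR

set_option maxHeartbeats 400000 in
/-- **THE FORM DEFECT OF `Δ^{(n+1)}_a` BETWEEN TWO SMALL BACKGROUNDS ON THE DIAGONAL, MODULO `C_R^{(2)}`**: `∃ α₀ δ₀ Θ̄₂ > 0` (closed in
`(d, a, L, M_φ, M_φ′, r, C_τ, ρ_w, C_R^{(2)})`) such that under E162's per-level data for `U` and `V` (the base also `α′_j ≤ 1∕128`), common level smallness
`ε_j ≤ αr^j`, level closeness `δ_j ≤ δr^j`, `hRS`, unit bounds, the windows `αη` (bonds), `αη²` (plaquettes of `U`), the closeness windows `δη` (bonds), `δη²`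
(plaquettes), `0 ≤ α ≤ α₀`, `0 ≤ δ ≤ δ₀` and the `R`-letter `C_R^{(2)}δ`: `‖⟨u, Δ_a(U)v⟩ − ⟨u, Δ_a(V)v⟩‖ ≤ Θ̄₂·δ·N₁(u)N₁(v)`, `N₁` the FLAT energy weight —
FIRST-order letters only (two-background curl ∕ divergence remainders, the η-free curvature letter, `C_R^{(2)}δ`, `δ_Q(U,V)`, the base's sizes at `V`).
[cite: Balaban1985BackgroundPropagators, (3.52)–(3.53) p.400, (3.82)–(3.86) p.407, (3.35) p.396, (3.26) p.395] -/
theorem exists_form_defect_two_backgrounds_diagonal_closed :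
    ∃ α₀ δ₀ Θ : ℝ, 0 < α₀ ∧ 0 < δ₀ ∧ 0 < Θ ∧ ∀ (n : ℕ) (η : ℝ), η * (L : ℝ) ^ (n + 1) = 1 →
      ∀ (c₀ c₁ : ℝ) [Fact (0 < c₀)] [Fact (0 < c₁)], c₀ * ((L : ℝ) ^ (n + 1)) ^ d = c₁ → |η| ^ d / c₀ ≤ ρw →
      ∀ (m : Fin d → ℕ) [∀ i, NeZero (m i)] (U V : Bond d (towerP L m (n + 1)) → 𝔸ˣ) (αU : ℕ → ℝ) (hα1 : ∀ j, αU j ≤ 1 / 64)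
        (hU1 : ∀ (j : ℕ) (x : B7Prop1Explicit.Site d) (κ : Fin d), perCfg (towerP L m (j + 1)) (UlevOf L m (n + 1) U j) x κ ∈ U1 𝔸)
        (hreg : ∀ (j : ℕ) (y : TSite d (towerP L m j)) (κ : Fin d) (r : Fin d → Fin L),
          ‖((Wcx L (perCfg (towerP L m (j + 1)) (UlevOf L m (n + 1) U j)) (cornerSite L y) κ (boxVec L r) : 𝔸ˣ) : 𝔸) - 1‖ ≤ αU j)
        (αV : ℕ → ℝ) (hα1' : ∀ j, αV j ≤ 1 / 64)
        (hV1 : ∀ (j : ℕ) (x : B7Prop1Explicit.Site d) (κ : Fin d), perCfg (towerP L m (j + 1)) (UlevOf L m (n + 1) V j) x κ ∈ U1 𝔸)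
        (hregV : ∀ (j : ℕ) (y : TSite d (towerP L m j)) (κ : Fin d) (r : Fin d → Fin L),
          ‖((Wcx L (perCfg (towerP L m (j + 1)) (UlevOf L m (n + 1) V j)) (cornerSite L y) κ (boxVec L r) : 𝔸ˣ) : 𝔸) - 1‖ ≤ αV j),
        (∀ j, αV j ≤ 1 / 128) →
      ∀ (εU : ℕ → ℝ), (∀ j, 0 ≤ εU j) → (∀ (j : ℕ) (b : Bond d (towerP L m (j + 1))), ‖(UlevOf L m (n + 1) U j b : 𝔸) - 1‖ ≤ εU j) →
        (∀ (j : ℕ) (b : Bond d (towerP L m (j + 1))), ‖(UlevOf L m (n + 1) V j b : 𝔸) - 1‖ ≤ εU j) →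
      ∀ (δUV : ℕ → ℝ), (∀ j, 0 ≤ δUV j) →
        (∀ (j : ℕ) (b : Bond d (towerP L m (j + 1))), ‖(UlevOf L m (n + 1) U j b : 𝔸) - (UlevOf L m (n + 1) V j b : 𝔸)‖ ≤ δUV j) →
      ∀ {α δ : ℝ}, 0 ≤ α → α ≤ α₀ → 0 ≤ δ → δ ≤ δ₀ →
        (∀ (b : Bond d (towerP L m (n + 1))) (v u : W), ⟪adTransportW φ U b v, u⟫_ℂ = ⟪v, adTransportW φ (fun b => (U b)⁻¹) b u⟫_ℂ) →
        (∀ (b : Bond d (towerP L m (n + 1))) (v u : W), ⟪adTransportW φ V b v, u⟫_ℂ = ⟪v, adTransportW φ (fun b => (V b)⁻¹) b u⟫_ℂ) →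
        (∀ b, U b ∈ U1 𝔸) → (∀ b, V b ∈ U1 𝔸) → (∀ b, ‖(U b : 𝔸) - 1‖ ≤ α * η) → (∀ b, ‖(V b : 𝔸) - 1‖ ≤ α * η) →
        (∀ p : B9SectCLatticeCarrier.Plaq d (towerP L m (n + 1)), ‖(plaqHolU U p : 𝔸) - 1‖ ≤ α * η ^ 2) →
        (∀ b, ‖(U b : 𝔸) - (V b : 𝔸)‖ ≤ δ * η) →
        (∀ p : B9SectCLatticeCarrier.Plaq d (towerP L m (n + 1)), ‖(plaqHolU U p : 𝔸) - (plaqHolU V p : 𝔸)‖ ≤ δ * η ^ 2) →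
        (∀ j < n + 1, εU j ≤ α * r ^ j) → (∀ j, δUV j ≤ δ * r ^ j) →
        (∀ s : SiteL2K ℂ d (towerP L m (n + 1)) c₀ W, ‖RofUk L m n φ η U s - RofUk L m n φ η V s‖ ≤ CR * δ * ‖s‖) →
        ∀ u v : BondL2K ℂ d (towerP L m (n + 1)) c₀ W,
            ‖⟪u, laplaceAk L m n φ η U hL αU hα1 hU1 hreg τ (c₀ := c₀) (c₁ := c₁) a v⟫_ℂ -
                ⟪u, laplaceAk L m n φ η V hL αV hα1' hV1 hregV τ (c₀ := c₀) (c₁ := c₁) a v⟫_ℂ‖ ≤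
              Θ * δ * Real.sqrt (‖covCurlL2K ℂ c₀ ((η : ℂ))⁻¹ (adTransportW φ (fun _ : Bond d (towerP L m (n + 1)) => (1 : 𝔸ˣ))) u‖ ^ 2 + ‖covDivL2K ℂ c₀ ((η : ℂ))⁻¹ (adTransportW φ fun _ : Bond d (towerP L m (n + 1)) => (1 : 𝔸ˣ)⁻¹) u‖ ^ 2 + ‖u‖ ^ 2) * Real.sqrt (‖covCurlL2K ℂ c₀ ((η : ℂ))⁻¹ (adTransportW φ (fun _ : Bond d (towerP L m (n + 1)) => (1 : 𝔸ˣ))) v‖ ^ 2 + ‖covDivL2K ℂ c₀ ((η : ℂ))⁻¹ (adTransportW φ fun _ : Bond d (towerP L m (n + 1)) => (1 : 𝔸ˣ)⁻¹) v‖ ^ 2 + ‖v‖ ^ 2) := by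
  have hL1 : (1 : ℝ) ≤ L := by exact_mod_cast hL
  have h1r : 0 < 1 - r := by linarith
  obtain ⟨sD, hsDdef⟩ : ∃ sD : ℝ, sD = 8 * Real.sqrt d * (Mφ * Mφ') := ⟨_, rfl⟩
  obtain ⟨sS, hsSdef⟩ : ∃ sS : ℝ, sS = 2 * Real.sqrt d * (Mφ * Mφ') := ⟨_, rfl⟩
  obtain ⟨Kc, hKcdef⟩ : ∃ Kc : ℝ, Kc = 16 * d * Cτ * Mφ ^ 2 * ρw * 15 := ⟨_, rfl⟩
  obtain ⟨Ξ, hΞdef⟩ : ∃ Ξ : ℝ, Ξ = Real.sqrt ((L : ℝ) ^ d) * (Real.sqrt (2 * d) * (102 * (d + 1) ^ 2 * L)) := ⟨_, rfl⟩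
  obtain ⟨BQ, hBQdef⟩ : ∃ BQ : ℝ, BQ = Real.sqrt ((L : ℝ) ^ d) * (Real.sqrt (2 * d) * (75497472 * ((d : ℝ) + 1) * ((2 * (d * L) + L + L : ℕ) : ℝ))) / (1 - r) := ⟨_, rfl⟩
  obtain ⟨CQ, hCQdef⟩ : ∃ CQ : ℝ, CQ = 2 * (Mφ' * Mφ) * Ξ / (1 - r) := ⟨_, rfl⟩
  obtain ⟨sQ, hsQdef⟩ : ∃ sQ : ℝ, sQ = Mφ' * Mφ * (2 * Real.exp 1 * BQ) := ⟨_, rfl⟩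
  obtain ⟨Θb, hΘbdef⟩ : ∃ Θb : ℝ, Θb = sD * (2 * (1 + sD * 1) + sD * 1) + Kc + (sS + CR * (1 + sS * 1)) * (2 * (1 + sS * 1) + (sS * 1 + CR * 1 * (1 + sS * 1))) +
      a * (sQ * (2 * (Mφ' * Mφ + CQ * 1) + sQ * 1)) := ⟨_, rfl⟩
  have hsD : 0 ≤ sD := by rw [hsDdef]; positivity
  have hsS : 0 ≤ sS := by rw [hsSdef]; positivity
  have hKc : 0 ≤ Kc := by rw [hKcdef]; positivity
  have hΞ0 : 0 ≤ Ξ := by rw [hΞdef]; positivity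
  have hBQ : 0 ≤ BQ := by rw [hBQdef]; positivity
  have hCQ : 0 ≤ CQ := by rw [hCQdef]; positivity
  have hsQ : 0 ≤ sQ := by rw [hsQdef]; positivity
  have hMM : 0 ≤ Mφ' * Mφ := mul_nonneg hMφ' hMφ
  have hΘb : 0 ≤ Θb := by rw [hΘbdef]; positivity
  have hNN : (0 : ℝ) < 12288 * ((2 * (d * L) + L + L : ℕ) : ℝ) := by
    have : (1 : ℝ) ≤ ((2 * (d * L) + L + L : ℕ) : ℝ) := by exact_mod_cast (show 1 ≤ 2 * (d * L) + L + L by nlinarith [hL])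
    positivity
  refine ⟨min 1 ((1 - r) / (Ξ + 1)), min 1 (min (1 / (12288 * ((2 * (d * L) + L + L : ℕ) : ℝ))) (1 / (BQ + 1))), Θb + 1,
    lt_min one_pos (by positivity), lt_min one_pos (lt_min (by positivity) (by positivity)), by positivity, ?_⟩
  intro n η hηL c₀ c₁ _ _ hw hρ m _ U V αU hα1 hU1 hreg αV hα1' hV1 hregV hα128 εU hεU hUε hVε δUV hδUV hLUV α δ hα0 hαle hδ0 hδle
    hRSU hRSV hUb hVb hUη hVη hpl hUV hpp hεg hδg hR2 u v
  have hc₀ : 0 < c₀ := Fact.out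
  have hc₁ : 0 < c₁ := Fact.out
  have hLr : (1 : ℝ) ≤ (L : ℝ) ^ (n + 1) := one_le_pow₀ hL1
  have hηL0 : 0 < η * (L : ℝ) ^ (n + 1) := by rw [hηL]; exact one_pos
  have hη0 : 0 < η := pos_of_mul_pos_left hηL0 (by positivity)
  have hη1 : η ≤ 1 := by
    have : η * 1 ≤ η * (L : ℝ) ^ (n + 1) := mul_le_mul_of_nonneg_left hLr hη0.le
    rw [mul_one, hηL] at this; exact this
  have hc : conj ((η : ℂ))⁻¹ = ((η : ℂ))⁻¹ := by rw [map_inv₀, Complex.conj_ofReal]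
  have hnη : ‖((η : ℂ))⁻¹‖ * η = 1 := by
    rw [norm_inv, Complex.norm_real, Real.norm_eq_abs, abs_of_pos hη0, inv_mul_cancel₀ hη0.ne']
  have hnη2 : ‖((η : ℂ))⁻¹‖ ^ 2 * η ^ 2 = 1 := by rw [← mul_pow, hnη, one_pow]
  have hs : c₁ * (η * (L : ℝ) ^ (n + 1)) ^ 2 = c₀ * ((L : ℝ) ^ (n + 1)) ^ d := by rw [hηL, one_pow, mul_one, hw]
  have hαone : α ≤ 1 := hαle.trans (min_le_left _ _)
  have hδone : δ ≤ 1 := hδle.trans (min_le_left _ _)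
  have hδN : δ ≤ 1 / (12288 * ((2 * (d * L) + L + L : ℕ) : ℝ)) := hδle.trans ((min_le_right _ _).trans (min_le_left _ _))
  have hδB : BQ * δ ≤ 1 := by
    have h1 : δ ≤ 1 / (BQ + 1) := hδle.trans ((min_le_right _ _).trans (min_le_right _ _))
    calc BQ * δ ≤ BQ * (1 / (BQ + 1)) := mul_le_mul_of_nonneg_left h1 hBQ
      _ ≤ 1 := by rw [mul_one_div, div_le_one (by positivity)]; linarith
  have hαΞ : Ξ * (α / (1 - r)) ≤ 1 := by
    have h1 : α ≤ (1 - r) / (Ξ + 1) := hαle.trans (min_le_right _ _)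
    rw [← mul_div_assoc, div_le_one h1r]
    calc Ξ * α ≤ Ξ * ((1 - r) / (Ξ + 1)) := mul_le_mul_of_nonneg_left h1 hΞ0
      _ ≤ 1 - r := by
          rw [mul_div_assoc', div_le_iff₀ (add_pos_of_nonneg_of_pos hΞ0 one_pos)]
          calc Ξ * (1 - r) ≤ Ξ * (1 - r) + (1 - r) := le_add_of_nonneg_right h1r.le
            _ = (1 - r) * (Ξ + 1) := by ring
  have hαη : 0 ≤ α * η := mul_nonneg hα0 hη0.le
  have hδη : 0 ≤ δ * η := mul_nonneg hδ0 hη0.le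
  have hεR0 : 0 ≤ 2 * Mφ * Mφ' * (α * η) := mul_nonneg (mul_nonneg (mul_nonneg zero_le_two hMφ) hMφ') hαη
  have hδR0 : 0 ≤ 2 * Mφ * Mφ' * (δ * η) := mul_nonneg (mul_nonneg (mul_nonneg zero_le_two hMφ) hMφ') hδη
  have hαη2 : 0 ≤ α * η ^ 2 := mul_nonneg hα0 (sq_nonneg η)
  have hδη2 : 0 ≤ δ * η ^ 2 := mul_nonneg hδ0 (sq_nonneg η)
  have hsDα : 0 ≤ sD * α := mul_nonneg hsD hα0
  have hsDδ : 0 ≤ sD * δ := mul_nonneg hsD hδ0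
  have hsSα : 0 ≤ sS * α := mul_nonneg hsS hα0
  have hsSδ : 0 ≤ sS * δ := mul_nonneg hsS hδ0
  have hCQα : 0 ≤ CQ * α := mul_nonneg hCQ hα0
  have hCRδ : 0 ≤ CR * δ := mul_nonneg hCR hδ0
  have hsQδ : 0 ≤ sQ * δ := mul_nonneg hsQ hδ0
  have hMD0 : 0 ≤ 1 + sD * α := by positivity
  have hMP0 : 0 ≤ 1 + sS * α := by positivity
  have hδP0 : 0 ≤ sS * δ + CR * δ * (1 + sS * α) := by positivity
  have hMQ0 : 0 ≤ Mφ' * Mφ + CQ * α := by positivity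
  have he : Real.exp (Ξ * (α / (1 - r))) - 1 ≤ 2 * (Ξ * (α / (1 - r))) :=
    exp_sub_one_le_two_mul (mul_nonneg hΞ0 (div_nonneg hα0 h1r.le)) hαΞ
  have heM : Mφ' * Mφ * (Real.exp (Ξ * (α / (1 - r))) - 1) ≤ CQ * α := by
    have h1 := mul_le_mul_of_nonneg_left he hMM
    have h2 : Mφ' * Mφ * (2 * (Ξ * (α / (1 - r)))) = CQ * α := by rw [hCQdef]; ring
    rw [← h2]; exact h1
  have hsDe : 4 * Real.sqrt d * (‖((η : ℂ))⁻¹‖ * (2 * Mφ * Mφ' * (α * η))) = sD * α := by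
    rw [hsDdef, show ‖((η : ℂ))⁻¹‖ * (2 * Mφ * Mφ' * (α * η)) = 2 * Mφ * Mφ' * α * (‖((η : ℂ))⁻¹‖ * η) by ring, hnη]; ring
  have hsDe₂ : 4 * Real.sqrt d * (‖((η : ℂ))⁻¹‖ * (2 * Mφ * Mφ' * (δ * η))) = sD * δ := by
    rw [hsDdef, show ‖((η : ℂ))⁻¹‖ * (2 * Mφ * Mφ' * (δ * η)) = 2 * Mφ * Mφ' * δ * (‖((η : ℂ))⁻¹‖ * η) by ring, hnη]; ring
  have hsSe : ‖((η : ℂ))⁻¹‖ * (2 * Mφ * Mφ' * (α * η)) * Real.sqrt d = sS * α := by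
    rw [hsSdef, show ‖((η : ℂ))⁻¹‖ * (2 * Mφ * Mφ' * (α * η)) = 2 * Mφ * Mφ' * α * (‖((η : ℂ))⁻¹‖ * η) by ring, hnη]; ring
  have hsSe₂ : ‖((η : ℂ))⁻¹‖ * (2 * Mφ * Mφ' * (δ * η)) * Real.sqrt d = sS * δ := by
    rw [hsSdef, show ‖((η : ℂ))⁻¹‖ * (2 * Mφ * Mφ' * (δ * η)) = 2 * Mφ * Mφ' * δ * (‖((η : ℂ))⁻¹‖ * η) by ring, hnη]; ring
  have hK2 : 16 * d * Cτ * Mφ ^ 2 * (|η| ^ d / c₀) * (‖((η : ℂ))⁻¹‖ ^ 2 * (12 * (δ * η) * (α * η ^ 2) + 3 * (δ * η ^ 2))) ≤ Kc * δ := by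
    rw [hKcdef]; exact curv_coeff_le hCτ hc₀ hρ hnη2 hαone hη0.le hη1 hδ0
  have hna : ‖((a : ℝ) : ℂ)‖ = a := by rw [Complex.norm_real, Real.norm_eq_abs, abs_of_pos ha]
  obtain ⟨Θδ, hΘδdef⟩ : ∃ Θδ : ℝ, Θδ = ((sD * δ) * (2 * (1 + sD * α) + sD * δ) + Kc * δ) +
      (sS * δ + CR * δ * (1 + sS * α)) * (2 * (1 + sS * α) + (sS * δ + CR * δ * (1 + sS * α))) +
      a * ((sQ * δ) * (2 * (Mφ' * Mφ + CQ * α) + sQ * δ)) := ⟨_, rfl⟩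
  have hΘle : Θδ ≤ (Θb + 1) * δ := by
    have hbr := bracket_le (sD := sD) (Kc := Kc) (sS := sS) (CR := CR) (sQ := sQ) (MQ := Mφ' * Mφ) (CQ := CQ) (a := a) hα0 hαone hδ0 hδone hsD
      hsS hCR hsQ hCQ ha.le
    rw [← hΘbdef] at hbr
    have hfac : Θδ = δ * (sD * (2 * (1 + sD * α) + sD * δ) + Kc + (sS + CR * (1 + sS * α)) * (2 * (1 + sS * α) + (sS * δ + CR * δ * (1 + sS * α))) +
        a * (sQ * (2 * (Mφ' * Mφ + CQ * α) + sQ * δ))) := by rw [hΘδdef]; ring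
    rw [hfac, mul_comm (Θb + 1) δ]
    exact mul_le_mul_of_nonneg_left (hbr.trans (le_add_of_nonneg_right zero_le_one)) hδ0
  obtain ⟨N, hNdef⟩ : ∃ N : BondL2K ℂ d (towerP L m (n + 1)) c₀ W → ℝ, N = fun z =>
      Real.sqrt (‖covCurlL2K ℂ c₀ ((η : ℂ))⁻¹ (adTransportW φ (fun _ : Bond d (towerP L m (n + 1)) => (1 : 𝔸ˣ))) z‖ ^ 2 + ‖covDivL2K ℂ c₀ ((η : ℂ))⁻¹ (adTransportW φ fun _ : Bond d (towerP L m (n + 1)) => (1 : 𝔸ˣ)⁻¹) z‖ ^ 2 + ‖z‖ ^ 2) := ⟨_, rfl⟩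
  have hNz : ∀ z, N z = Real.sqrt (‖covCurlL2K ℂ c₀ ((η : ℂ))⁻¹ (adTransportW φ (fun _ : Bond d (towerP L m (n + 1)) => (1 : 𝔸ˣ))) z‖ ^ 2 + ‖covDivL2K ℂ c₀ ((η : ℂ))⁻¹ (adTransportW φ fun _ : Bond d (towerP L m (n + 1)) => (1 : 𝔸ˣ)⁻¹) z‖ ^ 2 + ‖z‖ ^ 2) := fun z => by rw [hNdef]
  have hN0 : ∀ z, 0 ≤ N z := fun z => by rw [hNz]; exact Real.sqrt_nonneg _
  have hNn : ∀ z, ‖z‖ ≤ N z := fun z => by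
    rw [hNz]; exact le_sqrt_of_sq_le (norm_nonneg _) (le_add_of_nonneg_left (add_nonneg (sq_nonneg _) (sq_nonneg _)))
  have hNc : ∀ z, ‖covCurlL2K ℂ c₀ ((η : ℂ))⁻¹ (adTransportW φ (fun _ : Bond d (towerP L m (n + 1)) => (1 : 𝔸ˣ))) z‖ ≤ N z := fun z => by
    rw [hNz]; exact le_sqrt_of_sq_le (norm_nonneg _) ((le_add_of_nonneg_right (sq_nonneg _)).trans (le_add_of_nonneg_right (sq_nonneg _)))
  have hNd : ∀ z, ‖covDivL2K ℂ c₀ ((η : ℂ))⁻¹ (adTransportW φ fun _ : Bond d (towerP L m (n + 1)) => (1 : 𝔸ˣ)⁻¹) z‖ ≤ N z := fun z => by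
    rw [hNz]; exact le_sqrt_of_sq_le (norm_nonneg _) ((le_add_of_nonneg_left (sq_nonneg _)).trans (le_add_of_nonneg_right (sq_nonneg _)))
  have hRεU : ∀ (b : Bond d (towerP L m (n + 1))) (w : W), ‖adTransportW φ U b w - w‖ ≤ (2 * Mφ * Mφ' * (α * η)) * ‖w‖ := fun b w => norm_adTransportW_sub_le φ hφ hφ' hMφ' U b (hUb b) (hUη b) w
  have hRεV : ∀ (b : Bond d (towerP L m (n + 1))) (w : W), ‖adTransportW φ V b w - w‖ ≤ (2 * Mφ * Mφ' * (α * η)) * ‖w‖ := fun b w => norm_adTransportW_sub_le φ hφ hφ' hMφ' V b (hVb b) (hVη b) w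
  have hRUV : ∀ (b : Bond d (towerP L m (n + 1))) (w : W), ‖adTransportW φ U b w - adTransportW φ V b w‖ ≤ (2 * Mφ * Mφ' * (δ * η)) * ‖w‖ :=
    fun b w => norm_adTransportW_sub_adTransportW_le (L := L) (m := towerP L m n) φ hφ hφ' hMφ' U V b (hUb b) (hVb b) (hUV b) w
  have hR₁ : ∀ (b : Bond d (towerP L m (n + 1))) (w : W), adTransportW φ (fun _ : Bond d (towerP L m (n + 1)) => (1 : 𝔸ˣ)) b w = w := fun b w => by rw [adTransportW_one]; rfl
  have hS₁ : ∀ (b : Bond d (towerP L m (n + 1))) (w : W), adTransportW φ (fun _ : Bond d (towerP L m (n + 1)) => (1 : 𝔸ˣ)⁻¹) b w = w := fun b w => by rw [adTransportW_inv_one]; rfl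
  have hD : ∀ w : BondL2K ℂ d (towerP L m (n + 1)) c₀ W, ‖covCurlL2K ℂ c₀ ((η : ℂ))⁻¹ (adTransportW φ U) w - covCurlL2K ℂ c₀ ((η : ℂ))⁻¹ (adTransportW φ V) w‖ ≤ (sD * δ) * N w := fun w => by
    have h := norm_covCurlL2K_sub_le₂ ((η : ℂ))⁻¹ hδR0 hRUV w
    rw [hsDe₂] at h
    exact h.trans (mul_le_mul_of_nonneg_left (hNn w) hsDδ)
  have hDV : ∀ w : BondL2K ℂ d (towerP L m (n + 1)) c₀ W, ‖covCurlL2K ℂ c₀ ((η : ℂ))⁻¹ (adTransportW φ V) w‖ ≤ (1 + sD * α) * N w := fun w => by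
    have h := norm_covCurlL2K_sub_le ((η : ℂ))⁻¹ hεR0 hRεV hR₁ w
    rw [hsDe] at h
    have h2 := norm_le_norm_add_norm_sub' (covCurlL2K ℂ c₀ ((η : ℂ))⁻¹ (adTransportW φ V) w) (covCurlL2K ℂ c₀ ((η : ℂ))⁻¹ (adTransportW φ (fun _ : Bond d (towerP L m (n + 1)) => (1 : 𝔸ˣ))) w)
    have h3 : sD * α * ‖w‖ ≤ sD * α * N w := mul_le_mul_of_nonneg_left (hNn w) hsDα
    calc _ ≤ N w + sD * α * N w := h2.trans (add_le_add (hNc w) (h.trans h3))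
      _ = (1 + sD * α) * N w := by ring
  have hSUV : ∀ w : BondL2K ℂ d (towerP L m (n + 1)) c₀ W, ‖covDivL2K ℂ c₀ ((η : ℂ))⁻¹ (adTransportW φ fun b => (U b)⁻¹) w - covDivL2K ℂ c₀ ((η : ℂ))⁻¹ (adTransportW φ fun b => (V b)⁻¹) w‖ ≤ (sS * δ) * ‖w‖ := fun w => by
    have h := norm_covDivL2K_sub_le₂ ((η : ℂ))⁻¹ hc hδR0 hRUV hRSU hRSV w
    rw [hsSe₂] at h; exact h
  have hSV : ∀ w : BondL2K ℂ d (towerP L m (n + 1)) c₀ W, ‖covDivL2K ℂ c₀ ((η : ℂ))⁻¹ (adTransportW φ fun b => (V b)⁻¹) w‖ ≤ (1 + sS * α) * N w := fun w => by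
    have h := norm_covDivL2K_sub_le ((η : ℂ))⁻¹ hc hεR0 hRεV hR₁ hRSV hS₁ w
    rw [hsSe] at h
    have h2 := norm_le_norm_add_norm_sub' (covDivL2K ℂ c₀ ((η : ℂ))⁻¹ (adTransportW φ fun b => (V b)⁻¹) w) (covDivL2K ℂ c₀ ((η : ℂ))⁻¹ (adTransportW φ fun _ : Bond d (towerP L m (n + 1)) => (1 : 𝔸ˣ)⁻¹) w)
    have h3 : sS * α * ‖w‖ ≤ sS * α * N w := mul_le_mul_of_nonneg_left (hNn w) hsSα
    calc _ ≤ N w + sS * α * N w := h2.trans (add_le_add (hNd w) (h.trans h3))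
      _ = (1 + sS * α) * N w := by ring
  have hprU : ∀ u v : BondL2K ℂ d (towerP L m (n + 1)) c₀ W, ⟪u, principalOpK φ η U v⟫_ℂ = ⟪covCurlL2K ℂ c₀ ((η : ℂ))⁻¹ (adTransportW φ U) u, covCurlL2K ℂ c₀ ((η : ℂ))⁻¹ (adTransportW φ U) v⟫_ℂ := fun u v => by
    rw [principalOpK_eq_comp, covCoCurlL2K_comp_eq_adjoint_comp _ hc _ _ hRSU, LinearMap.comp_apply, LinearMap.adjoint_inner_right]
  have hprV : ∀ u v : BondL2K ℂ d (towerP L m (n + 1)) c₀ W, ⟪u, principalOpK φ η V v⟫_ℂ = ⟪covCurlL2K ℂ c₀ ((η : ℂ))⁻¹ (adTransportW φ V) u, covCurlL2K ℂ c₀ ((η : ℂ))⁻¹ (adTransportW φ V) v⟫_ℂ := fun u v => by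
    rw [principalOpK_eq_comp, covCoCurlL2K_comp_eq_adjoint_comp _ hc _ _ hRSV, LinearMap.comp_apply, LinearMap.adjoint_inner_right]
  have hUb' : ∀ b : Bond d (towerP L m (n + 1)), ‖(U b : 𝔸)‖ ≤ 1 ∧ ‖(((U b)⁻¹ : 𝔸ˣ) : 𝔸)‖ ≤ 1 := fun b => B7Prop1Explicit.mem_U1.1 (hUb b)
  have hVb' : ∀ b : Bond d (towerP L m (n + 1)), ‖(V b : 𝔸)‖ ≤ 1 ∧ ‖(((V b)⁻¹ : 𝔸ˣ) : 𝔸)‖ ≤ 1 := fun b => B7Prop1Explicit.mem_U1.1 (hVb b)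
  have hKop : ∀ v : BondL2K ℂ d (towerP L m (n + 1)) c₀ W, ‖curvOp φ τ η U v - curvOp φ τ η V v‖ ≤ Kc * δ * ‖v‖ := fun v => by
    have h := norm_curvOp_sub_le_of_plaq φ hτ hCτ hφ η hUb' hVb' hδη hUV hδη2 hpp hαη2 hpl hMφ v
    exact h.trans (mul_le_mul_of_nonneg_right hK2 (norm_nonneg _))
  have hΔ : ∀ u v : BondL2K ℂ d (towerP L m (n + 1)) c₀ W, ‖⟪u, hessOp φ η U τ v⟫_ℂ - ⟪u, hessOp φ η V τ v⟫_ℂ‖ ≤ ((sD * δ) * (2 * (1 + sD * α) + sD * δ) + Kc * δ) * N u * N v := by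
    intro u v
    rw [hessOp_apply, hessOp_apply, inner_add_right, inner_add_right, hprU, hprV, add_sub_add_comm, ← inner_sub_right]
    have hbr := norm_inner_sub_inner_le (𝕜 := ℂ) (fun w => covCurlL2K ℂ c₀ ((η : ℂ))⁻¹ (adTransportW φ U) w) (fun w => covCurlL2K ℂ c₀ ((η : ℂ))⁻¹ (adTransportW φ V) w) N hN0 hsDδ hMD0 hD hDV u v
    have hcv : ‖⟪u, curvOp φ τ η U v - curvOp φ τ η V v⟫_ℂ‖ ≤ Kc * δ * N u * N v :=
      calc ‖⟪u, curvOp φ τ η U v - curvOp φ τ η V v⟫_ℂ‖ ≤ ‖u‖ * ‖curvOp φ τ η U v - curvOp φ τ η V v‖ := norm_inner_le_norm _ _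
        _ ≤ N u * (Kc * δ * N v) := mul_le_mul (hNn u) ((hKop v).trans (mul_le_mul_of_nonneg_left (hNn v) (mul_nonneg hKc hδ0))) (norm_nonneg _) (hN0 u)
        _ = Kc * δ * N u * N v := by ring
    calc _ ≤ ‖⟪covCurlL2K ℂ c₀ ((η : ℂ))⁻¹ (adTransportW φ U) u, covCurlL2K ℂ c₀ ((η : ℂ))⁻¹ (adTransportW φ U) v⟫_ℂ - ⟪covCurlL2K ℂ c₀ ((η : ℂ))⁻¹ (adTransportW φ V) u, covCurlL2K ℂ c₀ ((η : ℂ))⁻¹ (adTransportW φ V) v⟫_ℂ‖ + ‖⟪u, curvOp φ τ η U v - curvOp φ τ η V v⟫_ℂ‖ := norm_add_le _ _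
      _ ≤ (sD * δ) * (2 * (1 + sD * α) + sD * δ) * N u * N v + Kc * δ * N u * N v := add_le_add hbr hcv
      _ = ((sD * δ) * (2 * (1 + sD * α) + sD * δ) + Kc * δ) * N u * N v := by ring
  have hRle : ∀ v : SiteL2K ℂ d (towerP L m (n + 1)) c₀ W, ‖RofUk L m n φ η U v‖ ≤ ‖v‖ := fun v => by unfold RofUk B11Eq103H1Complex.RLatticeK; exact norm_projR_le _ _ v
  have hRVle : ∀ v : SiteL2K ℂ d (towerP L m (n + 1)) c₀ W, ‖RofUk L m n φ η V v‖ ≤ ‖v‖ := fun v => by unfold RofUk B11Eq103H1Complex.RLatticeK; exact norm_projR_le _ _ v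
  have hP : ∀ w : BondL2K ℂ d (towerP L m (n + 1)) c₀ W, ‖RofUk L m n φ η U (covDivL2K ℂ c₀ ((η : ℂ))⁻¹ (adTransportW φ fun b => (U b)⁻¹) w) - RofUk L m n φ η V (covDivL2K ℂ c₀ ((η : ℂ))⁻¹ (adTransportW φ fun b => (V b)⁻¹) w)‖ ≤ (sS * δ + CR * δ * (1 + sS * α)) * N w := by
    intro w
    have h1 : ‖RofUk L m n φ η U (covDivL2K ℂ c₀ ((η : ℂ))⁻¹ (adTransportW φ fun b => (U b)⁻¹) w) - RofUk L m n φ η U (covDivL2K ℂ c₀ ((η : ℂ))⁻¹ (adTransportW φ fun b => (V b)⁻¹) w)‖ ≤ (sS * δ) * ‖w‖ := by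
      rw [← map_sub]; exact (hRle _).trans (hSUV w)
    have h2 := hR2 (covDivL2K ℂ c₀ ((η : ℂ))⁻¹ (adTransportW φ fun b => (V b)⁻¹) w)
    have h3 := norm_sub_le_norm_sub_add_norm_sub (RofUk L m n φ η U (covDivL2K ℂ c₀ ((η : ℂ))⁻¹ (adTransportW φ fun b => (U b)⁻¹) w)) (RofUk L m n φ η U (covDivL2K ℂ c₀ ((η : ℂ))⁻¹ (adTransportW φ fun b => (V b)⁻¹) w))
      (RofUk L m n φ η V (covDivL2K ℂ c₀ ((η : ℂ))⁻¹ (adTransportW φ fun b => (V b)⁻¹) w))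
    have h4 : (sS * δ) * ‖w‖ ≤ (sS * δ) * N w := mul_le_mul_of_nonneg_left (hNn w) hsSδ
    have h5 : CR * δ * ‖covDivL2K ℂ c₀ ((η : ℂ))⁻¹ (adTransportW φ fun b => (V b)⁻¹) w‖ ≤ CR * δ * ((1 + sS * α) * N w) := mul_le_mul_of_nonneg_left (hSV w) hCRδ
    have h6 : (sS * δ) * N w + CR * δ * ((1 + sS * α) * N w) = (sS * δ + CR * δ * (1 + sS * α)) * N w := by ring
    exact h3.trans ((add_le_add (h1.trans h4) (h2.trans h5)).trans h6.le)
  have hP₀ : ∀ w : BondL2K ℂ d (towerP L m (n + 1)) c₀ W, ‖RofUk L m n φ η V (covDivL2K ℂ c₀ ((η : ℂ))⁻¹ (adTransportW φ fun b => (V b)⁻¹) w)‖ ≤ (1 + sS * α) * N w :=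
    fun w => (hRVle _).trans (hSV w)
  have hδmax : ∀ j, δUV j ≤ 1 / (12288 * ((2 * (d * L) + L + L : ℕ) : ℝ)) := fun j => by
    have h1 : δUV j ≤ δ * r ^ j := hδg j
    have h2 : δ * r ^ j ≤ δ := mul_le_of_le_one_right hδ0 (pow_le_one₀ hr0 hr1.le)
    exact h1.trans (h2.trans hδN)
  have hwin : Real.sqrt ((L : ℝ) ^ d) * (Real.sqrt (2 * d) * (75497472 * ((d : ℝ) + 1) * ((2 * (d * L) + L + L : ℕ) : ℝ))) / (1 - r) * δ ≤ 1 := by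
    rw [← hBQdef]; exact hδB
  have hQd : ∀ w : BondL2K ℂ d (towerP L m (n + 1)) c₀ W, ‖QkW L m n φ U hL αU hα1 hU1 hreg (c₀ := c₀) (c₁ := c₁) w - QkW L m n φ V hL αV hα1' hV1 hregV (c₀ := c₀) (c₁ := c₁) w‖ ≤ (sQ * δ) * N w := fun w => by
    have h := norm_QkW_sub_QkW_le_L2_linear L m n hL φ hMφ hMφ' hφ hφ' (c₀ := c₀) (c₁ := c₁) U V αU hα1 hU1 hreg αV hα1' hV1 hregV hα128 εU hεU hUε hVε
      δUV hδUV hδmax hLUV hr0 hr1 hα0 hδ0 hεg (fun j _ => hδg j) hwin w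
    rw [sqrt_ratio_diagonal hc₁ hw, mul_one, ← hBQdef] at h
    have hexp : Real.exp (Real.sqrt ((L : ℝ) ^ d) * (Real.sqrt (2 * d) * (102 * (d + 1) ^ 2 * L)) * (α / (1 - r))) ≤ Real.exp 1 := by
      rw [← hΞdef]; exact Real.exp_le_exp.2 hαΞ
    have h2 : Mφ' * Mφ * (2 * Real.exp (Real.sqrt ((L : ℝ) ^ d) * (Real.sqrt (2 * d) * (102 * (d + 1) ^ 2 * L)) * (α / (1 - r))) * (BQ * δ)) ≤ sQ * δ := by
      rw [hsQdef]
      have := mul_le_mul_of_nonneg_right hexp (mul_nonneg hBQ hδ0)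
      calc Mφ' * Mφ * (2 * Real.exp (Real.sqrt ((L : ℝ) ^ d) * (Real.sqrt (2 * d) * (102 * (d + 1) ^ 2 * L)) * (α / (1 - r))) * (BQ * δ))
          = (Mφ' * Mφ * 2) * (Real.exp (Real.sqrt ((L : ℝ) ^ d) * (Real.sqrt (2 * d) * (102 * (d + 1) ^ 2 * L)) * (α / (1 - r))) * (BQ * δ)) := by ring
        _ ≤ (Mφ' * Mφ * 2) * (Real.exp 1 * (BQ * δ)) := mul_le_mul_of_nonneg_left this (by positivity)
        _ = Mφ' * Mφ * (2 * Real.exp 1 * BQ) * δ := by ring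
    exact h.trans ((mul_le_mul_of_nonneg_right h2 (norm_nonneg _)).trans (mul_le_mul_of_nonneg_left (hNn w) hsQδ))
  have hQ₁ : ∀ w : BondL2K ℂ d (towerP L m (n + 1)) c₀ W, ‖QkW L m n φ (fun _ : Bond d (towerP L m (n + 1)) => (1 : 𝔸ˣ)) hL (fun _ => 0) (fun _ => by norm_num)
        (perCfg_UlevOf_one_mem_U1 L m (n + 1)) (norm_Wcx_UlevOf_one_sub_one_le L m (n + 1) (fun _ => 0) (fun _ => le_rfl)) (c₀ := c₀) (c₁ := c₁) w‖ ≤ Mφ' * Mφ * ‖w‖ := fun w => by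
    have h := norm_QkW_one_le_canonical L m n hL φ hMφ hφ hMφ' hφ' (fun _ => 0) (fun _ => by norm_num)
      (perCfg_UlevOf_one_mem_U1 L m (n + 1)) (norm_Wcx_UlevOf_one_sub_one_le L m (n + 1) (fun _ => 0) (fun _ => le_rfl)) (c₀ := c₀)
      (c₁ := c₁) hηL0 hs w
    rw [hηL, inv_one, mul_one] at h
    exact h
  have hQV : ∀ w : BondL2K ℂ d (towerP L m (n + 1)) c₀ W, ‖QkW L m n φ V hL αV hα1' hV1 hregV (c₀ := c₀) (c₁ := c₁) w‖ ≤ (Mφ' * Mφ + CQ * α) * N w := fun w => by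
    have h := norm_QkW_sub_flat_le_L2_geometric L m n hL φ hMφ hMφ' hφ hφ' (c₀ := c₀) (c₁ := c₁) V αV hα1' hV1 hregV εU hεU hVε hr0 hr1 hα0
      hεg w
    rw [sqrt_ratio_diagonal hc₁ hw, mul_one, ← hΞdef] at h
    have hd : ‖QkW L m n φ V hL αV hα1' hV1 hregV (c₀ := c₀) (c₁ := c₁) w - QkW L m n φ (fun _ : Bond d (towerP L m (n + 1)) => (1 : 𝔸ˣ)) hL (fun _ => 0) (fun _ => by norm_num)
        (perCfg_UlevOf_one_mem_U1 L m (n + 1)) (norm_Wcx_UlevOf_one_sub_one_le L m (n + 1) (fun _ => 0) (fun _ => le_rfl)) (c₀ := c₀) (c₁ := c₁) w‖ ≤ CQ * α * ‖w‖ :=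
      h.trans (mul_le_mul_of_nonneg_right heM (norm_nonneg _))
    have h2 := norm_le_norm_add_norm_sub' (QkW L m n φ V hL αV hα1' hV1 hregV (c₀ := c₀) (c₁ := c₁) w) (QkW L m n φ (fun _ : Bond d (towerP L m (n + 1)) => (1 : 𝔸ˣ)) hL (fun _ => 0) (fun _ => by norm_num)
        (perCfg_UlevOf_one_mem_U1 L m (n + 1)) (norm_Wcx_UlevOf_one_sub_one_le L m (n + 1) (fun _ => 0) (fun _ => le_rfl)) (c₀ := c₀) (c₁ := c₁) w)
    calc _ ≤ Mφ' * Mφ * ‖w‖ + CQ * α * ‖w‖ := h2.trans (add_le_add (hQ₁ w) hd)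
      _ = (Mφ' * Mφ + CQ * α) * ‖w‖ := by ring
      _ ≤ (Mφ' * Mφ + CQ * α) * N w := mul_le_mul_of_nonneg_left (hNn w) hMQ0
  have hadjU : ∀ (x : BondL2K ℂ d (towerP L m (n + 1)) c₀ W) (z : BondL2K ℂ d m c₁ W),
      ⟪QkW L m n φ U hL αU hα1 hU1 hreg (c₁ := c₁) x, z⟫_ℂ = ⟪x, LinearMap.adjoint (QkW L m n φ U hL αU hα1 hU1 hreg (c₁ := c₁)) z⟫_ℂ :=
    fun x z => (LinearMap.adjoint_inner_right _ x z).symm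
  have hadjV : ∀ (x : BondL2K ℂ d (towerP L m (n + 1)) c₀ W) (z : BondL2K ℂ d m c₁ W),
      ⟪QkW L m n φ V hL αV hα1' hV1 hregV (c₁ := c₁) x, z⟫_ℂ = ⟪x, LinearMap.adjoint (QkW L m n φ V hL αV hα1' hV1 hregV (c₁ := c₁)) z⟫_ℂ :=
    fun x z => (LinearMap.adjoint_inner_right _ x z).symm
  have hDDU : ∀ (s : SiteL2K ℂ d (towerP L m (n + 1)) c₀ W) (x : BondL2K ℂ d (towerP L m (n + 1)) c₀ W),
      ⟪covDerivL2K ℂ c₀ ((η : ℂ))⁻¹ (adTransportW φ U) s, x⟫_ℂ = ⟪s, covDivL2K ℂ c₀ ((η : ℂ))⁻¹ (adTransportW φ fun b => (U b)⁻¹) x⟫_ℂ := by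
    intro s x; rw [← adjoint_covDerivL2K ((η : ℂ))⁻¹ hc _ _ hRSU, LinearMap.adjoint_inner_right]
  have hDDV : ∀ (s : SiteL2K ℂ d (towerP L m (n + 1)) c₀ W) (x : BondL2K ℂ d (towerP L m (n + 1)) c₀ W),
      ⟪covDerivL2K ℂ c₀ ((η : ℂ))⁻¹ (adTransportW φ V) s, x⟫_ℂ = ⟪s, covDivL2K ℂ c₀ ((η : ℂ))⁻¹ (adTransportW φ fun b => (V b)⁻¹) x⟫_ℂ := by
    intro s x; rw [← adjoint_covDerivL2K ((η : ℂ))⁻¹ hc _ _ hRSV, LinearMap.adjoint_inner_right]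
  have hRsymU : ∀ s t : SiteL2K ℂ d (towerP L m (n + 1)) c₀ W, ⟪RofUk L m n φ η U s, t⟫_ℂ = ⟪s, RofUk L m n φ η U t⟫_ℂ := fun s t => RofUk_isSymmetric L m n φ η U s t
  have hRsymV : ∀ s t : SiteL2K ℂ d (towerP L m (n + 1)) c₀ W, ⟪RofUk L m n φ η V s, t⟫_ℂ = ⟪s, RofUk L m n φ η V t⟫_ℂ := fun s t => RofUk_isSymmetric L m n φ η V s t
  have hRRU : ∀ s : SiteL2K ℂ d (towerP L m (n + 1)) c₀ W, RofUk L m n φ η U (RofUk L m n φ η U s) = RofUk L m n φ η U s :=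
    fun s => by unfold RofUk B11Eq103H1Complex.RLatticeK; exact projR_projR _ _ s
  have hRRV : ∀ s : SiteL2K ℂ d (towerP L m (n + 1)) c₀ W, RofUk L m n φ η V (RofUk L m n φ η V s) = RofUk L m n φ η V s :=
    fun s => by unfold RofUk B11Eq103H1Complex.RLatticeK; exact projR_projR _ _ s
  have hT : ‖⟪u, laplaceAk L m n φ η U hL αU hα1 hU1 hreg τ (c₀ := c₀) (c₁ := c₁) a v⟫_ℂ -
      ⟪u, laplaceAk L m n φ η V hL αV hα1' hV1 hregV τ (c₀ := c₀) (c₁ := c₁) a v⟫_ℂ‖ ≤ Θδ * N u * N v := by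
    have h := norm_inner_laplaceAK_sub_le (𝕜 := ℂ) (a := ((a : ℝ) : ℂ)) hadjV hDDV hRsymV hRRV hadjU hDDU hRsymU hRRU N hN0 hδP0 hMP0 hsQδ hMQ0
      hΔ hP hP₀ hQd hQV u v
    rw [hna, ← hΘδdef] at h
    rw [laplaceAk, laplaceAk, laplaceALatticeK, laplaceALatticeK]
    exact h
  have hNuv : 0 ≤ N u * N v := mul_nonneg (hN0 u) (hN0 v)
  have h1 : Θδ * N u * N v ≤ (Θb + 1) * δ * N u * N v := by
    have h3 := mul_le_mul_of_nonneg_right hΘle hNuv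
    simpa only [mul_assoc] using h3
  rw [← hNz u, ← hNz v]
  exact hT.trans h1

end Literature.MathematicalPhysics.QuantumFieldTheory.Balaban1983to89.B9Eq353FormDefectTowerTwoBackgrounds

end
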